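import Summits.ABC.IUTFork.Joshi.ATS4DescentSpine
import Summits.ABC.IUTFork.Joshi.ATS4DescentToFirstMainBound

/-!
# Joshi, *Arithmetic Teichmüller Spaces IV* (arXiv:2403.10430v2) §6.10–§6.12 — a MODEL of the END-TO-END E5 descent spine:
# ONE glued triple (E-t4's `SecondMainBoundDatum`, E-t31's `LocusVolumeDatum`, E-t30's `MainBoundDatum`) at which every named
# input holds, so that the two PROVED compositions `DescentGlue.secondMainBound_of_inputs` (p431424) and
# `MainBoundGlue.thm611_left_of_inputs` (p433649) fire together (non-vacuity of the spine across the three carriers)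

Companion of `Joshi/ATS4DescentSpine.lean` and `Joshi/ATS4DescentToFirstMainBound.lean` (abc-iut cell, branch E, rung LADDER-ABC:A2.E;
seat abc-iut-E-t31, slot T-31; AUTHORS-FIRST non-vacuity witness for the seat's own bridge files). Those files PROVE, by composition
only, the printed descent [J-III] Cor 9.11.1.1 at `φ(y₀)` ⟹ [J-IV] Thm 6.10.1 ⟹ `C_Θ ≥ −1` ⟹ Thm 6.1.1 (first inequality, `ℓ ≥ 7`)
from NAMED inputs: E-t4's three [J-III] inputs at `φ(y₀)` ((9.9.4) valuation scaling, Lemma 9.10.7.1 at the exhibited element, «LogVol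
≤ 0»), E-t31's eight [J-IV] §6.8/§6.11 inputs ((6.11.1), Prop 6.10.9 on `V^dst_ℚ`, the component sums, (6.8.11), Lemma 6.7.8, the two
Frobenius-shift equalities, «(1/2ℓ) log q = |log q_ℓ|»), E-t30's three §6.4 inputs (Lemma 6.4.1, Thm 4.6.1 (5) for `L′/L`,
`[L′ : L] ≤ ℓ⁴`) and `ℓ ≥ 7`, under the two glue structures `DescentGlue` (6 identifications) and `MainBoundGlue` (8 identifications).
Here: ONE explicit triple at which the fourteen inputs AND both glues hold (`spine_inputs`, `spine_glue`) — so the identifications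
are jointly consistent with the inputs (e.g. `η_prm = 60`, `e*_mod = 2¹²·3³·5·e_mod`, `ℓ = 2ℓ* + 1 = 7`, `|log(q_ℓ)| = Σ_w |log|q_w^{1/2ℓ}||`,
`C_Θ` = the printed formula) — and at which, BY THE PROVED COMPOSITIONS and not by hand, E-t4's `SecondMainBound`, `C_Θ ≥ −1`,
E-t31's `Thm6101` and Thm 6.1.1's first inequality all hold (`spine_end_to_end`). The triple is a TOY of the three SIGNATURES (one
place `w`, `ℓ* = 3`, `|q_w^{1/2ℓ}| = e^{−5}`, unit hull-volumes, `ℓ = 7`, `d_mod = e_mod = 1`, `log(q) = 70`, `log(d_{L′}) = log(d_L) =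
12`, one distinguished rational prime carrying every component); it models nothing of the arithmetic of any curve. **No side is taken**
on [IUTchIII] Cor. 3.12 / [IUTchIV] Thm 1.10 or on any author; a model exhibits satisfiability of reading predicates over typed
signatures, nothing more. [claim: Joshi2024ATS4, status: disputed]; [claim: Joshi2024ATS3, status: disputed] (locators only); the
theorems are [folklore].
-/

noncomputable section

namespace Summit.ABC.IUTFork.Joshi.ATS4

open LocusVolumeDatum

/-! ## 1. The triple -/

/-- One local [J-III] locus datum with `ℓ* = 3`: `|q_w^{1/2ℓ}| = e^{−5}`, the exhibited norms `|q_w^{1/2ℓ}|^{j²/ℓ*²}` (so (9.9.4)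
holds by construction), sup-norm and hull-volume `1`. [folklore] -/
def spineLocus : ATS3.LocusDatum 3 where
  qroot := Real.exp (-5)
  qroot_pos := Real.exp_pos _
  qroot_lt_one := Real.exp_lt_one_iff.2 (by norm_num)
  theta := fun i => Real.exp (-5) ^ ATS3.LocusDatum.scalingExponent 3 i
  supNorm := 1
  hullVol := 1

/-- E-t31's §6.8–§6.11 carrier of the triple: `ℓ = 7` (`ℓ* = 3`), `d_mod = 1`, `e*_mod = 2¹²·3³·5`, `η_prm = 60`, `log(d_{L_tpd}) =
log(f_{L_tpd}) = log(s_ℚ) = log(s^≤_ℚ) = 0`, `log(d_{L′}) = 12`, `log(q) = 70`, `V^dst_ℚ = {2}` carrying the whole of each component,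
all log-volumes `0`, `|log(q_ℓ)| = 5 = (1/2ℓ)·log(q)` at `y₀` and at `φ(y₀)`. [folklore] -/
def spineVolume : LocusVolumeDatum where
  l := 7
  five_le_l := by norm_num
  dmod := 1
  one_le_dmod := le_rfl
  estar := 552960
  estar_ge := le_rfl
  eta := 60
  eta_nonneg := by norm_num
  logDiffTpd := 0
  logDiffTpd_nonneg := le_rfl
  logCondTpd := 0
  logCondTpd_nonneg := le_rfl
  logDiffLp := 12
  logq := 70
  logq_nonneg := by norm_num
  logsQ := 0
  logsLe := 0
  Vdst := {2}
  logDiffLpAt := fun _ => 12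
  logqAt := fun _ => 70
  logsQAt := fun _ => 0
  logsLeAt := fun _ => 0
  logVolAt := fun _ => 0
  logVolArch := 0
  logVolHull := 0
  logVolHullFrob := 0
  absLogThetaQ := 5
  absLogThetaQ_pos := by norm_num
  absLogThetaQFrob := 5

/-- E-t4's carrier of the triple: the same local datum at `y₀` and at `φ(y₀)` over ONE place, with `C_Θ :=` the printed formula's
value at `spineVolume` (as `DescentGlue.cTheta_eq` demands). [folklore] -/
def spineSecond : SecondMainBoundDatum 3 Unit where
  std := { loc := fun _ => spineLocus }
  shift := { loc := fun _ => spineLocus }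
  CTheta := spineVolume.CTheta

/-- E-t30's Thm 6.1.1 carrier of the triple: `ℓ = 7`, `d_mod = e_mod = 1`, `log(q) = 70`, `log(d_{L_tpd}) = log(f_{L_tpd}) = 0`,
`log(d_L) = log(d_{L′}) = 12`, all conductors `0`, `[L : L_tpd] = [L′ : L] = 1`. [folklore] -/
def spineMain : MainBoundDatum where
  ell := 7
  ell_prime := by norm_num
  five_le_ell := by norm_num
  dmod := 1
  one_le_dmod := le_rfl
  emod := 1
  one_le_emod := le_rfl
  emod_le_dmod := le_rfl
  logq := 70
  logq_pos := by norm_num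
  logDiffLtpd := 0
  logDiffLtpd_nonneg := le_rfl
  logCondLtpd := 0
  logCondLtpd_nonneg := le_rfl
  logDiffL := 12
  logDiffL_nonneg := by norm_num
  logCondL := 0
  logCondL_nonneg := le_rfl
  logDiffLp := 12
  logDiffLp_nonneg := by norm_num
  logCondLp := 0
  logCondLp_nonneg := le_rfl
  degLLtpd := 1
  one_le_degLLtpd := le_rfl
  degLpL := 1
  one_le_degLpL := le_rfl

/-! ## 2. The glues and the inputs hold at the triple -/

/-- `Σ_w |log|q_w^{1/2ℓ}||` over the one place is `5`. [folklore] -/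
theorem spine_absLogQl : (⟨fun _ => spineLocus⟩ : ATS3.AdelicLocusDatum 3 Unit).absLogQl = 5 := by
  simp only [ATS3.AdelicLocusDatum.absLogQl, Finset.univ_unique, Finset.sum_singleton, spineLocus, Real.log_exp, abs_neg]
  norm_num

/-- `Σ_w |log Vol(Θ̃_w)|` over the one place is `0`. [folklore] -/
theorem spine_absLogVol : (⟨fun _ => spineLocus⟩ : ATS3.AdelicLocusDatum 3 Unit).absLogVol = 0 := by
  simp [ATS3.AdelicLocusDatum.absLogVol, spineLocus]

/-- **Both glue structures hold at the triple** (the 6 + 8 identifications are jointly consistent with the inputs below).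
[folklore] -/
theorem spine_glue : DescentGlue spineSecond spineVolume ∧ MainBoundGlue spineMain spineVolume := by
  refine ⟨⟨?_, ?_, ?_, ?_, ?_, rfl⟩, ⟨rfl, rfl, ?_, ?_, rfl, rfl, rfl, rfl⟩⟩
  · simp only [spineVolume]; norm_num
  · change (5 : ℝ) = (⟨fun _ => spineLocus⟩ : ATS3.AdelicLocusDatum 3 Unit).absLogQl
    rw [spine_absLogQl]
  · change |(5 : ℝ)| = (⟨fun _ => spineLocus⟩ : ATS3.AdelicLocusDatum 3 Unit).absLogQl
    rw [spine_absLogQl]; norm_num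
  · change |(0 : ℝ)| = (⟨fun _ => spineLocus⟩ : ATS3.AdelicLocusDatum 3 Unit).absLogVol
    rw [spine_absLogVol, abs_zero]
  · change |(0 : ℝ)| = (⟨fun _ => spineLocus⟩ : ATS3.AdelicLocusDatum 3 Unit).absLogVol
    rw [spine_absLogVol, abs_zero]
  · change (552960 : ℝ) = ((2 ^ 12 * 3 ^ 3 * 5 * 1 : ℕ) : ℝ)
    norm_num
  · change (60 : ℝ) = etaPrm
    unfold etaPrm; rfl

/-- **All fourteen named inputs of the spine hold at the triple**: E-t4's three [J-III] inputs at `φ(y₀)`; E-t31's eight [J-IV]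
§6.8/§6.11 inputs; `ℓ ≥ 7` and E-t30's three §6.4 inputs. [folklore] -/
theorem spine_inputs :
    (spineSecond.shift.ValuationScaling ∧ spineSecond.shift.HullVolumeLowerBound ∧ spineSecond.shift.LogVolNonpos) ∧
    (spineVolume.Eq6111 ∧ (∀ p ∈ spineVolume.Vdst, spineVolume.Prop6109 p) ∧ spineVolume.ComponentSums ∧ spineVolume.Eq6811 ∧
      spineVolume.Lem678 ∧ spineVolume.FrobShiftQ ∧ spineVolume.FrobShiftVol ∧ spineVolume.LogqDictionary) ∧
    (7 ≤ spineMain.ell ∧ spineMain.Lem641 ∧ spineMain.WildBoundLp ∧ spineMain.DegLpLBound) := by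
  have h210 : 0 ≤ Real.log 210 := Real.log_nonneg (by norm_num)
  refine ⟨⟨fun _ _ => rfl, fun _ => ?_, fun _ => le_rfl⟩, ⟨?_, ?_, ?_, ?_, ?_, ?_, ?_, ?_⟩, ⟨le_rfl, ?_, ?_, ?_⟩⟩
  · -- Lemma 9.10.7.1 at the exhibited element: `∏_i e^{−5·j²/ℓ*²} ≤ 1`
    change ∏ i, Real.exp (-5) ^ ATS3.LocusDatum.scalingExponent 3 i ≤ (1 : ℝ)
    refine Finset.prod_le_one (fun i _ => Real.rpow_nonneg (Real.exp_pos _).le _) fun i _ => ?_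
    exact Real.rpow_le_one (Real.exp_pos _).le (Real.exp_lt_one_iff.2 (by norm_num)).le
      (by unfold ATS3.LocusDatum.scalingExponent; positivity)
  · simp [Eq6111, spineVolume]
  · intro p hp
    simp only [Prop6109, spineVolume, lstar, abs_zero, mul_zero]
    norm_num
  · simp [ComponentSums, spineVolume]
  · simp only [Eq6811, spineVolume]; norm_num; exact h210
  · simp only [Lem678, spineVolume]; norm_num
  · simp [FrobShiftQ, spineVolume]
  · simp [FrobShiftVol, spineVolume]
  · simp only [LogqDictionary, spineVolume]; norm_num
  · change (12 : ℝ) + 0 ≤ 0 + 0 + 33; norm_num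
  · change ((12 : ℝ) + 0) - (12 + 0) ≤ 1 * Real.log ((1 : ℕ) : ℝ); simp
  · change 1 ≤ 7 ^ 4; norm_num

/-! ## 3. The whole spine fires at the triple -/

/-- **Non-vacuity of the END-TO-END spine**: at the triple, BY THE PROVED COMPOSITIONS (`DescentGlue.secondMainBound_of_inputs`,
`DescentGlue.lowerBound_of_cor91111`, `LocusVolumeDatum.thm6101_of_inputs`, `MainBoundGlue.thm611_left_of_inputs`), E-t4's
`SecondMainBound` and `C_Θ ≥ −1`, E-t31's `LowerBound` and `Thm6101`, and the first inequality of E-t30's Thm 6.1.1 hold.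
[folklore] -/
theorem spine_end_to_end :
    (spineSecond.SecondMainBound ∧ spineSecond.CThetaGeNegOne) ∧ spineVolume.LowerBound ∧ spineVolume.Thm6101 ∧
      1 / 6 * spineMain.logq ≤ spineMain.boundLtpd := by
  obtain ⟨⟨s₁, s₂, s₃⟩, ⟨h₁, h₂, h₃, h₅, h₆, h₈, h₉, hD⟩, ⟨h7, m₁, m₂, m₃⟩⟩ := spine_inputs
  obtain ⟨G, G'⟩ := spine_glue
  have h₇ : spineVolume.LowerBound := G.lowerBound_of_cor91111 (spineSecond.shift.cor91111_of_inputs s₁ s₂ s₃) h₈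
  have h₄ : spineVolume.Lem642₂ := G'.lem642_iff.2 (spineMain.lem642b_of_lem642a (spineMain.lem642a_of m₁ m₂ m₃))
  exact ⟨G.secondMainBound_of_inputs s₁ s₂ s₃ h₁ h₂ h₃ h₄ h₅ h₆ h₈ h₉ hD, h₇,
    spineVolume.thm6101_of_inputs h₁ h₂ h₃ h₄ h₅ h₆ h₇ h₈ h₉ hD,
    G'.thm611_left_of_inputs h7 m₁ m₂ m₃ h₁ h₂ h₃ h₅ h₆ h₇ h₈ h₉ hD⟩

/-- In particular Lemma 6.4.2 (2) — the one §6 input the spine DERIVES (from E-t30's §6.4 inputs through `MainBoundGlue.lem642_iff`)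
rather than takes — holds at the triple, and `C_Θ ≥ −1` there reads `−1 ≤ spineVolume.CTheta`. [folklore] -/
theorem spine_lem642_and_cTheta : spineVolume.Lem642₂ ∧ -1 ≤ spineVolume.CTheta := by
  obtain ⟨-, -, h, -⟩ := spine_end_to_end
  obtain ⟨-, ⟨-, -, -, -, -, -, -, -⟩, ⟨-, m₁, m₂, m₃⟩⟩ := spine_inputs
  exact ⟨spine_glue.2.lem642_iff.2 (spineMain.lem642b_of_lem642a (spineMain.lem642a_of m₁ m₂ m₃)),
    spineVolume.neg_one_le_cTheta h⟩

end Summit.ABC.IUTFork.Joshi.ATS4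

end
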